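/-
Copyright (c) 2026. All rights reserved.
Released under Apache 2.0 license as described in the file LICENSE.
Authors: abc-iut cell, seat abc-iut-L4-t14 (gen 3; group-theoretic MODEL of the category of finite étale
localizations `Loc_R(X)` of [AbsTopIII] Prop 4.2 (i) p.106 and the exact id-rigidity criterion for it).
-/
import Literature.AnabelianGeometry.AbsoluteAnabelian.RigidFunctors
import Mathlib.GroupTheory.Index
import Mathlib.Tactic.Group
import Mathlib.Data.Fintype.Perm
import HarnessLib

/-!
# A group-theoretic model of `Loc_R(X)` and its id-rigidity ([AbsTopIII] Prop 4.2 (i), p.106)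

S. Mochizuki, *Topics in absolute anabelian geometry III*, proof of Prop 4.2 (i), kurims manuscript
p. 106 l. 14–19 (lit key `paper:url-5493eb38cbb7`; bib key `MochizukiAbsTopIII2015`): "To verify the
id-rigidity of `EA`, it suffices to observe that for any object `X ∈ Ob(EA)` …, the full subcategory of
`EA` consisting of objects that map to `X` may, by Corollary 2.3, (i) …, be identified with the category
of finite étale R-localizations '`Loc_R(X)`' …. Thus, the id-rigidity of `EA` follows immediately from
the slimness assertion of Lemma 4.3"; §0 p. 27 ("if the identity functor of `𝒞` is rigid, then we shall
say that `𝒞` is id-rigid" — abc-iut-L4-t2's `IsIdRigid`).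

MODEL (≠ reconstruction).  Under uniformisation `X = ℍ/Γ` the full subcategory «objects of `EA` that
map to `X`» is equivalent to the following category `Loc(N, Γ)` built from a pair of groups `Γ ≤ N`
(`N = Isom(ℍ)` for the RC-holomorphic widening of abc-iut-L4-t14's `geometricAutHolFieldFunctorRC`,
`N = PSL₂(ℝ)` for holomorphic morphisms; the identification is Cor 2.3 (i) + uniformisation +
covering-space theory — campaign-L, GAP row G-L4t14-R1, NOT constructed here):

* objects `LocObj Γ` = subgroups `Λ ≤ Γ` of finite index in `Γ` (the connected finite étale covers
  `ℍ/Λ → ℍ/Γ = X`, structure map forgotten but existent);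
* `Hom(Λ₁, Λ₂)` = elements `g ∈ N` with `g Λ₁ g⁻¹ ≤ Λ₂` (the maps `z ↦ g z : ℍ/Λ₁ → ℍ/Λ₂`), modulo
  LEFT multiplication by `Λ₂` (`g`, `λ g` induce the same map); composition = multiplication.

These morphisms are NOT required to lie over `X` (that is the point of `Loc(X)` versus the Galois
category of covers OF `X`: for `N = Γ` one recovers the connected finite `Γ`-sets, whose id-rigidity is
`Z(Γ̂) = 1` — the tree's `isIdRigid_bCat_iff_center_eq_bot` for profinite `Γ`).

RESULT (the printed one-line deduction made exact).  An automorphism `α` of `𝟭_{Loc(N,Γ)}` is a family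
of representatives `a_Λ ∈ N_N(Γ)` over the finite-index subgroups `Λ ⊴ Γ`, compatible
(`a_Λ a_{Λ'}⁻¹ ∈ Λ` for `Λ' ≤ Λ`) and `Γ`-central modulo `Λ` (`[a_Λ, γ] ∈ Λ`) — i.e. an element of the
CENTRALISER of `Γ̂` in the completion of `M := N_N(Γ)` along the finite-index normal subgroups of `Γ`.
Hence:

* `LocObj.CentralFamiliesTrivial Γ` — hypothesis (Z): every such family is trivial (`a_Λ ∈ Λ`), stated
  finitely (no completion object is formed);
* `LocObj.isIdRigid_of_centralFamiliesTrivial` — **(Z) ⟹ `Loc(N, Γ)` is id-rigid**;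
* `LocObj.centralFamiliesTrivial_of_finite` — for FINITE `Γ`, (Z) ⟸ `Z_N(Γ) ∩ N_N(Γ) = 1`;
  `LocObj.isIdRigid_of_finite`; NON-VACUOUS instance `LocObj.isIdRigid_symmetric_three` (`N = Γ = S₃`).

RESIDUAL for G-L4t14-R1 at the `EA` side, named exactly: (Z) for `Γ = π₁(X) ≤ N = Isom(ℍ)` follows from
`Z_{M̂}(Γ̂) = 1` with `[M : Γ] < ∞` (`M/Γ = Aut(X)`, finite for hyperbolic `X`), hence from the SLIMNESS
of `M̂ = Π_{[ℍ/M]}` — Lemma 4.3 applied to the quotient ORBICURVE `[X/Aut X]` (over `ℝ` in the RC case: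
`M` is then an NEC group, the `G ≅ ℤ/2ℤ` case of print's proof of Lemma 4.3), equivalently
`Z(Γ̂) = 1` together with `Aut(X) ↪ Out(Γ̂)`.  Nothing of this residual is proved here.

Refereed pre-IUT material; nothing here bears on [IUTchIII] Cor. 3.12 or takes a side; typed ≠ proved;
model ≠ reconstruction.
-/

set_option autoImplicit false

namespace Literature.AnabelianGeometry.AbsoluteAnabelian

open _root_.CategoryTheory

universe u

variable {N : Type u} [Group N] (Γ : Subgroup N)

/-- **Objects of the model `Loc(N, Γ)`**: subgroups `Λ ≤ Γ` of finite index in `Γ` (the connected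
finite étale covers `ℍ/Λ` of `X = ℍ/Γ`). [cite: MochizukiAbsTopIII2015, Proposition 4.2 (i) proof p.106] -/
structure LocObj : Type u where
  /-- the subgroup `Λ ≤ N` -/
  toSubgroup : Subgroup N
  /-- `Λ ≤ Γ` -/
  le : toSubgroup ≤ Γ
  /-- `[Γ : Λ] < ∞` -/
  finiteIndex : (toSubgroup.subgroupOf Γ).FiniteIndex

namespace LocObj

variable {Γ}

/-- Representatives of morphisms `Λ₁ → Λ₂`: the `g ∈ N` with `g Λ₁ g⁻¹ ≤ Λ₂` (the map `z ↦ g z`).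
[cite: MochizukiAbsTopIII2015, Proposition 4.2 (i) proof p.106] -/
def HomRep (Λ₁ Λ₂ : LocObj Γ) : Type u :=
  {g : N // ∀ x ∈ Λ₁.toSubgroup, g * x * g⁻¹ ∈ Λ₂.toSubgroup}

/-- Two representatives induce the same map iff they differ by LEFT multiplication by `Λ₂`.
[cite: MochizukiAbsTopIII2015, Proposition 4.2 (i) proof p.106] -/
def homSetoid (Λ₁ Λ₂ : LocObj Γ) : Setoid (HomRep Λ₁ Λ₂) where
  r g g' := g'.1 * g.1⁻¹ ∈ Λ₂.toSubgroup
  iseqv :=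
    { refl := fun g => by simp [mul_inv_cancel, Λ₂.toSubgroup.one_mem]
      symm := fun {g g'} h => by
        have := Λ₂.toSubgroup.inv_mem h
        simpa [mul_inv_rev] using this
      trans := fun {g g' g''} h h' => by
        have := Λ₂.toSubgroup.mul_mem h' h
        simpa [mul_assoc] using this }

/-- Morphisms of `Loc(N, Γ)`. [cite: MochizukiAbsTopIII2015, Proposition 4.2 (i) proof p.106] -/
def Hom (Λ₁ Λ₂ : LocObj Γ) : Type u := Quotient (homSetoid Λ₁ Λ₂)

/-- The identity representative. [cite: MochizukiAbsTopIII2015, Proposition 4.2 (i) proof p.106] -/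
def HomRep.id (Λ : LocObj Γ) : HomRep Λ Λ := ⟨1, fun x hx => by simpa using hx⟩

/-- Composition of representatives is multiplication (first `g`, then `h`: `z ↦ h (g z)`).
[cite: MochizukiAbsTopIII2015, Proposition 4.2 (i) proof p.106] -/
def HomRep.comp {Λ₁ Λ₂ Λ₃ : LocObj Γ} (g : HomRep Λ₁ Λ₂) (h : HomRep Λ₂ Λ₃) : HomRep Λ₁ Λ₃ :=
  ⟨h.1 * g.1, fun x hx => by
    have := h.2 _ (g.2 x hx)
    simpa [mul_assoc, mul_inv_rev] using this⟩

/-- Composition descends to classes. [cite: MochizukiAbsTopIII2015, Proposition 4.2 (i) proof p.106] -/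
theorem HomRep.comp_sound {Λ₁ Λ₂ Λ₃ : LocObj Γ} (g g' : HomRep Λ₁ Λ₂) (h h' : HomRep Λ₂ Λ₃)
    (hg : (homSetoid Λ₁ Λ₂).r g g') (hh : (homSetoid Λ₂ Λ₃).r h h') :
    (homSetoid Λ₁ Λ₃).r (g.comp h) (g'.comp h') := by
  change h'.1 * g'.1 * (h.1 * g.1)⁻¹ ∈ Λ₃.toSubgroup
  change g'.1 * g.1⁻¹ ∈ Λ₂.toSubgroup at hg
  change h'.1 * h.1⁻¹ ∈ Λ₃.toSubgroup at hh
  have h1 : h.1 * (g'.1 * g.1⁻¹) * h.1⁻¹ ∈ Λ₃.toSubgroup := h.2 _ hg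
  have h2 := Λ₃.toSubgroup.mul_mem hh h1
  have : h'.1 * g'.1 * (h.1 * g.1)⁻¹ = h'.1 * h.1⁻¹ * (h.1 * (g'.1 * g.1⁻¹) * h.1⁻¹) := by group
  rw [this]
  exact h2

/-- **The category `Loc(N, Γ)`** (model of print's `Loc_R(X)`: objects the finite étale covers of `X`,
morphisms ALL finite étale `R`-morphisms, not necessarily over `X`).
[cite: MochizukiAbsTopIII2015, Proposition 4.2 (i) proof p.106] -/
instance category : Category.{u} (LocObj Γ) where
  Hom := Hom
  id Λ := Quotient.mk _ (HomRep.id Λ)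
  comp f g := Quotient.map₂ HomRep.comp (fun a a' ha b b' hb => HomRep.comp_sound a a' b b' ha hb) f g
  id_comp := by
    intro Λ₁ Λ₂ f
    induction f using Quotient.inductionOn with
    | h g =>
      change Quotient.mk _ (HomRep.comp (HomRep.id Λ₁) g) = Quotient.mk _ g
      apply Quotient.sound
      change g.1 * (g.1 * 1)⁻¹ ∈ Λ₂.toSubgroup
      simp [Λ₂.toSubgroup.one_mem]
  comp_id := by
    intro Λ₁ Λ₂ f
    induction f using Quotient.inductionOn with
    | h g =>
      change Quotient.mk _ (HomRep.comp g (HomRep.id Λ₂)) = Quotient.mk _ g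
      apply Quotient.sound
      change g.1 * (1 * g.1)⁻¹ ∈ Λ₂.toSubgroup
      simp [Λ₂.toSubgroup.one_mem]
  assoc := by
    intro Λ₁ Λ₂ Λ₃ Λ₄ f g h
    induction f using Quotient.inductionOn with
    | h a =>
      induction g using Quotient.inductionOn with
      | h b =>
        induction h using Quotient.inductionOn with
        | h c =>
          change Quotient.mk _ (HomRep.comp (HomRep.comp a b) c) =
            Quotient.mk _ (HomRep.comp a (HomRep.comp b c))
          apply Quotient.sound
          change (c.1 * b.1 * a.1) * (c.1 * (b.1 * a.1))⁻¹ ∈ Λ₄.toSubgroup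
          simp [mul_assoc, Λ₄.toSubgroup.one_mem]

/-- The morphism `[g] : Λ₁ ⟶ Λ₂` of a representative. [cite: MochizukiAbsTopIII2015, Proposition 4.2 (i) proof p.106] -/
def homMk {Λ₁ Λ₂ : LocObj Γ} (g : N) (hg : ∀ x ∈ Λ₁.toSubgroup, g * x * g⁻¹ ∈ Λ₂.toSubgroup) :
    Λ₁ ⟶ Λ₂ :=
  Quotient.mk _ ⟨g, hg⟩

/-- Every morphism has a representative. [cite: MochizukiAbsTopIII2015, Proposition 4.2 (i) proof p.106] -/
theorem exists_eq_homMk {Λ₁ Λ₂ : LocObj Γ} (f : Λ₁ ⟶ Λ₂) :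
    ∃ (g : N) (hg : ∀ x ∈ Λ₁.toSubgroup, g * x * g⁻¹ ∈ Λ₂.toSubgroup), f = homMk g hg := by
  induction f using Quotient.inductionOn with
  | h g => exact ⟨g.1, g.2, rfl⟩

/-- `[g] = [g']` iff `g' g⁻¹ ∈ Λ₂`. [cite: MochizukiAbsTopIII2015, Proposition 4.2 (i) proof p.106] -/
theorem homMk_eq_homMk_iff {Λ₁ Λ₂ : LocObj Γ} {g g' : N}
    (hg : ∀ x ∈ Λ₁.toSubgroup, g * x * g⁻¹ ∈ Λ₂.toSubgroup)
    (hg' : ∀ x ∈ Λ₁.toSubgroup, g' * x * g'⁻¹ ∈ Λ₂.toSubgroup) :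
    (homMk g hg : Λ₁ ⟶ Λ₂) = homMk g' hg' ↔ g' * g⁻¹ ∈ Λ₂.toSubgroup :=
  ⟨fun h => Quotient.exact h, fun h => Quotient.sound h⟩

/-- The identity is `[1]`. [cite: MochizukiAbsTopIII2015, Proposition 4.2 (i) proof p.106] -/
theorem id_eq_homMk (Λ : LocObj Γ) : 𝟙 Λ = homMk 1 (HomRep.id Λ).2 := rfl

/-- `[g] ≫ [h] = [h g]`. [cite: MochizukiAbsTopIII2015, Proposition 4.2 (i) proof p.106] -/
theorem homMk_comp_homMk {Λ₁ Λ₂ Λ₃ : LocObj Γ} (g h : N)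
    (hg : ∀ x ∈ Λ₁.toSubgroup, g * x * g⁻¹ ∈ Λ₂.toSubgroup)
    (hh : ∀ x ∈ Λ₂.toSubgroup, h * x * h⁻¹ ∈ Λ₃.toSubgroup) :
    (homMk g hg ≫ homMk h hh : Λ₁ ⟶ Λ₃) = homMk (h * g) (HomRep.comp ⟨g, hg⟩ ⟨h, hh⟩).2 := rfl

/-! ### Distinguished objects: `Γ` itself and relative normal cores -/

variable (Γ) in
/-- The object `Γ` (the curve `X` itself). [cite: MochizukiAbsTopIII2015, Proposition 4.2 (i) proof p.106] -/
def top : LocObj Γ where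
  toSubgroup := Γ
  le := le_rfl
  finiteIndex := by rw [Subgroup.subgroupOf_self]; infer_instance

/-- The subgroup of the object `Γ` is `Γ`. [cite: MochizukiAbsTopIII2015, Proposition 4.2 (i) proof p.106] -/
@[simp] theorem top_toSubgroup : (top Γ).toSubgroup = Γ := rfl

/-- `Λ` is **normal in `Γ`** (a Galois cover of `X`). [cite: MochizukiAbsTopIII2015, Proposition 4.2 (i) proof p.106] -/
def IsNormal (Λ : LocObj Γ) : Prop :=
  ∀ γ ∈ Γ, ∀ x ∈ Λ.toSubgroup, γ * x * γ⁻¹ ∈ Λ.toSubgroup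

/-- The **normal core of `Λ` in `Γ`** as an object (the Galois closure of `ℍ/Λ → X`).
[cite: MochizukiAbsTopIII2015, Proposition 4.2 (i) proof p.106] -/
def core (Λ : LocObj Γ) : LocObj Γ where
  toSubgroup := (Λ.toSubgroup.subgroupOf Γ).normalCore.map Γ.subtype
  le := Subgroup.map_subtype_le _
  finiteIndex := by
    haveI := Λ.finiteIndex
    rw [← Subgroup.comap_subtype,
      Subgroup.comap_map_eq_self_of_injective Γ.subtype_injective]
    infer_instance

/-- The core lies in `Λ`. [cite: MochizukiAbsTopIII2015, Proposition 4.2 (i) proof p.106] -/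
theorem core_le (Λ : LocObj Γ) : Λ.core.toSubgroup ≤ Λ.toSubgroup := by
  rintro _ ⟨y, hy, rfl⟩
  exact Subgroup.mem_subgroupOf.mp (Subgroup.normalCore_le _ hy)

/-- The core is normal in `Γ`. [cite: MochizukiAbsTopIII2015, Proposition 4.2 (i) proof p.106] -/
theorem isNormal_core (Λ : LocObj Γ) : Λ.core.IsNormal := by
  rintro γ hγ _ ⟨y, hy, rfl⟩
  refine ⟨⟨γ, hγ⟩ * y * ⟨γ, hγ⟩⁻¹, ?_, by simp⟩
  exact (Subgroup.normalCore_normal _).conj_mem y hy ⟨γ, hγ⟩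

/-! ### Hypothesis (Z) and the id-rigidity theorem -/

variable (Γ) in
/-- **Hypothesis (Z) — compatible `Γ`-central families in `N_N(Γ)` are trivial.**  A family
`x_Λ ∈ N_N(Γ)` over the finite-index `Λ ⊴ Γ`, compatible (`x_Λ x_{Λ'}⁻¹ ∈ Λ` whenever `Λ' ≤ Λ`) and
central modulo each `Λ` (`x_Λ γ x_Λ⁻¹ γ⁻¹ ∈ Λ` for `γ ∈ Γ`), has `x_Λ ∈ Λ` for every such `Λ`.  This is
the statement «the centraliser of `Γ̂` in the completion of `N_N(Γ)` along the finite-index normal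
subgroups of `Γ` is trivial», written without forming the completion; for `Γ = π₁(X) ≤ Isom(ℍ)` it follows
from the slimness of `Π_{[X/Aut X]}` (Lemma 4.3 for the quotient orbicurve) — campaign-L, not proved here.
(The family is indexed by all objects; only its values at normal objects are constrained or concluded on.)
[cite: MochizukiAbsTopIII2015, Proposition 4.2 (i) proof p.106] -/
def CentralFamiliesTrivial : Prop :=
  ∀ x : LocObj Γ → N,
    (∀ Λ, Λ.IsNormal → x Λ ∈ Subgroup.normalizer (Γ : Set N)) →
    (∀ Λ Λ', Λ.IsNormal → Λ'.IsNormal → Λ'.toSubgroup ≤ Λ.toSubgroup →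
      x Λ * (x Λ')⁻¹ ∈ Λ.toSubgroup) →
    (∀ Λ, Λ.IsNormal → ∀ γ ∈ Γ, x Λ * γ * (x Λ)⁻¹ * γ⁻¹ ∈ Λ.toSubgroup) →
    ∀ Λ, Λ.IsNormal → x Λ ∈ Λ.toSubgroup

/-- **[AbsTopIII] Prop 4.2 (i), the `Loc_R(X)` step, in the group model: (Z) ⟹ `Loc(N, Γ)` is id-rigid.**
Proof (print: "follows immediately from the slimness assertion of Lemma 4.3"): choose representatives
`a_Λ` of the components of an automorphism `α` of `𝟭`; naturality along `[1] : Λ' → Λ` gives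
compatibility, along `[γ] : Λ → Λ` (`Λ ⊴ Γ`, `γ ∈ Γ`) centrality modulo `Λ`, and invertibility of `α_Γ`
gives `a_Γ ∈ N_N(Γ)`, whence all `a_Λ ∈ Γ a_Γ ⊆ N_N(Γ)`; (Z) yields `a_Λ ∈ Λ`, i.e. `α_Λ = id`, for
normal `Λ`, and naturality along the inclusion of the normal core extends this to every object.
[cite: MochizukiAbsTopIII2015, Proposition 4.2 (i) proof p.106] -/
theorem isIdRigid_of_centralFamiliesTrivial (hZ : CentralFamiliesTrivial Γ) :
    IsIdRigid (LocObj Γ) := by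
  intro α
  -- representatives of the components of `α`
  have hrep : ∀ Λ : LocObj Γ, ∃ (a : N) (ha : ∀ x ∈ Λ.toSubgroup, a * x * a⁻¹ ∈ Λ.toSubgroup),
      α.hom.app Λ = homMk a ha := fun Λ => exists_eq_homMk _
  choose a ha hα using hrep
  -- naturality: `a_{Λ₂} g a_{Λ₁}⁻¹ g⁻¹ ∈ Λ₂` for every representative `g : Λ₁ → Λ₂`
  have nat : ∀ {Λ₁ Λ₂ : LocObj Γ} (g : N)
      (hg : ∀ x ∈ Λ₁.toSubgroup, g * x * g⁻¹ ∈ Λ₂.toSubgroup),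
      a Λ₂ * g * (a Λ₁)⁻¹ * g⁻¹ ∈ Λ₂.toSubgroup := by
    intro Λ₁ Λ₂ g hg
    have h := α.hom.naturality (homMk g hg)
    simp only [Functor.id_obj, Functor.id_map, hα] at h
    rw [homMk_comp_homMk, homMk_comp_homMk, homMk_eq_homMk_iff] at h
    -- h : g * a Λ₁ * (a Λ₂ * g)⁻¹ ∈ Λ₂
    have h' := Λ₂.toSubgroup.inv_mem h
    have : (g * a Λ₁ * (a Λ₂ * g)⁻¹)⁻¹ = a Λ₂ * g * (a Λ₁)⁻¹ * g⁻¹ := by group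
    rwa [this] at h'
  -- `a_Γ` normalises `Γ`
  have htop : a (top Γ) ∈ Subgroup.normalizer (Γ : Set N) := by
    obtain ⟨b, hb, hβ⟩ := exists_eq_homMk (Λ₁ := top Γ) (Λ₂ := top Γ) (α.inv.app (top Γ))
    have h : (homMk b hb ≫ homMk (a (top Γ)) (ha (top Γ)) : top Γ ⟶ top Γ) = 𝟙 (top Γ) := by
      have := α.inv_hom_id_app (top Γ)
      rw [hβ, hα] at this
      exact this
    rw [homMk_comp_homMk, id_eq_homMk, homMk_eq_homMk_iff] at h
    -- h : 1 * (a top * b)⁻¹ ∈ Γ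
    have hab : a (top Γ) * b ∈ Γ := by
      have := Γ.inv_mem h
      simpa using this
    rw [Subgroup.mem_normalizer_iff]
    intro y
    constructor
    · intro hy; exact ha (top Γ) y hy
    · intro hy
      have h1 : (a (top Γ) * b)⁻¹ * (a (top Γ) * y * (a (top Γ))⁻¹) * (a (top Γ) * b) ∈ Γ :=
        Γ.mul_mem (Γ.mul_mem (Γ.inv_mem hab) hy) hab
      have h2 : b * ((a (top Γ) * b)⁻¹ * (a (top Γ) * y * (a (top Γ))⁻¹) * (a (top Γ) * b)) * b⁻¹ ∈
          (top Γ).toSubgroup := hb _ h1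
      have : b * ((a (top Γ) * b)⁻¹ * (a (top Γ) * y * (a (top Γ))⁻¹) * (a (top Γ) * b)) * b⁻¹ = y := by
        group
      rw [this] at h2
      exact h2
  -- all `a_Λ` normalise `Γ` (naturality along `[1] : Λ → Γ`)
  have hnorm : ∀ Λ : LocObj Γ, a Λ ∈ Subgroup.normalizer (Γ : Set N) := by
    intro Λ
    have h := nat (Λ₁ := Λ) (Λ₂ := top Γ) 1
      (fun x hx => by rw [top_toSubgroup]; simpa using Λ.le hx)
    simp only [mul_one, inv_one] at h
    replace h : a (top Γ) * (a Λ)⁻¹ ∈ Γ := h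
    have h' : (a (top Γ) * (a Λ)⁻¹)⁻¹ * a (top Γ) ∈ Subgroup.normalizer (Γ : Set N) :=
      (Subgroup.normalizer (Γ : Set N)).mul_mem ((Subgroup.normalizer (Γ : Set N)).inv_mem (Subgroup.le_normalizer h)) htop
    simpa [mul_assoc] using h'
  -- apply (Z)
  have hcentral := hZ a (fun Λ _ => hnorm Λ)
    (fun Λ Λ' _ _ hle => by
      have h := nat (Λ₁ := Λ') (Λ₂ := Λ) 1 (fun x hx => by simpa using hle hx)
      simpa using h)
    (fun Λ hΛ γ hγ => nat (Λ₁ := Λ) (Λ₂ := Λ) γ (hΛ γ hγ))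
  -- conclude `α_Λ = id` for every object, via its normal core
  have happ : ∀ Λ : LocObj Γ, α.hom.app Λ = 𝟙 Λ := by
    intro Λ
    have hc : a Λ.core ∈ Λ.core.toSubgroup := hcentral Λ.core Λ.isNormal_core
    have h := nat (Λ₁ := Λ.core) (Λ₂ := Λ) 1 (fun x hx => by simpa using Λ.core_le hx)
    simp only [mul_one, inv_one] at h
    -- h : a Λ * (a core)⁻¹ ∈ Λ
    have hmem : a Λ ∈ Λ.toSubgroup := by
      have := Λ.toSubgroup.mul_mem h (Λ.core_le hc)
      simpa using this
    calc α.hom.app Λ = homMk (a Λ) (ha Λ) := hα Λ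
      _ = homMk 1 (HomRep.id Λ).2 :=
          (homMk_eq_homMk_iff _ _).2 (by simpa using Λ.toSubgroup.inv_mem hmem)
      _ = 𝟙 Λ := rfl
  ext Λ
  exact happ Λ

/-! ### The finite case and a non-vacuous instance -/

variable (Γ) in
/-- For FINITE `Γ` the trivial subgroup is an object. [cite: MochizukiAbsTopIII2015, Proposition 4.2 (i) proof p.106] -/
def bot [Finite Γ] : LocObj Γ where
  toSubgroup := ⊥
  le := bot_le
  finiteIndex := by rw [Subgroup.bot_subgroupOf]; infer_instance

/-- The subgroup of the object `⊥` is `⊥`. [cite: MochizukiAbsTopIII2015, Proposition 4.2 (i) proof p.106] -/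
@[simp] theorem bot_toSubgroup [Finite Γ] : (bot Γ).toSubgroup = ⊥ := rfl

/-- **(Z) for finite `Γ`** ⟸ `Z_N(Γ) ∩ N_N(Γ) = 1`: evaluate the family at the object `⊥`.
[cite: MochizukiAbsTopIII2015, Proposition 4.2 (i) proof p.106] -/
theorem centralFamiliesTrivial_of_finite [Finite Γ]
    (h : ∀ z ∈ Subgroup.normalizer (Γ : Set N), (∀ γ ∈ Γ, z * γ = γ * z) → z = 1) :
    CentralFamiliesTrivial Γ := by
  intro x hxN hcompat hcentral Λ hΛ
  have hbotN : (bot Γ).IsNormal := fun γ _ y hy => by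
    simp only [bot_toSubgroup, Subgroup.mem_bot] at hy ⊢
    subst hy
    simp
  have hz : x (bot Γ) = 1 := by
    refine h _ (hxN _ hbotN) fun γ hγ => ?_
    have h1 := hcentral (bot Γ) hbotN γ hγ
    simp only [bot_toSubgroup, Subgroup.mem_bot] at h1
    -- h1 : x γ x⁻¹ γ⁻¹ = 1
    have : x (bot Γ) * γ = x (bot Γ) * γ * (x (bot Γ))⁻¹ * γ⁻¹ * (γ * x (bot Γ)) := by group
    rw [this, h1, one_mul]
  have := hcompat Λ (bot Γ) hΛ hbotN bot_le
  simpa [hz] using this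

/-- **Finite `Γ` with `Z_N(Γ) ∩ N_N(Γ) = 1` ⟹ `Loc(N, Γ)` id-rigid.**
[cite: MochizukiAbsTopIII2015, Proposition 4.2 (i) proof p.106] -/
theorem isIdRigid_of_finite [Finite Γ]
    (h : ∀ z ∈ Subgroup.normalizer (Γ : Set N), (∀ γ ∈ Γ, z * γ = γ * z) → z = 1) : IsIdRigid (LocObj Γ) :=
  isIdRigid_of_centralFamiliesTrivial (centralFamiliesTrivial_of_finite h)

/-- NON-VACUITY: `N = Γ = S₃` (centre-free) — the category of subgroups of `S₃` with the
`S₃`-conjugation-inclusions as morphisms is id-rigid. [cite: MochizukiAbsTopIII2015, Proposition 4.2 (i) proof p.106] -/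
theorem isIdRigid_symmetric_three : IsIdRigid (LocObj (⊤ : Subgroup (Equiv.Perm (Fin 3)))) := by
  refine isIdRigid_of_finite fun z hzN hz => ?_
  have hz' : ∀ γ : Equiv.Perm (Fin 3), z * γ = γ * z := fun γ => hz γ (Subgroup.mem_top γ)
  clear hz hzN
  revert z
  decide

end LocObj

end Literature.AnabelianGeometry.AbsoluteAnabelian
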